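import Mathlib
import HarnessLib
import Summits.CriticalPhenomena.Statement
import Literature.Probability.RandomPlanarGeometry.HexParafermion
import Literature.Probability.RandomPlanarGeometry.HexSAW
import Literature.Probability.RandomPlanarGeometry.SLE

/-!
Crux-ideate sketches for stmt-CriticalPhenomena-0808 (HexConjecture), ideator 3, round 1.
First lemmas of the idea cards `corner-phase-torque-pin` and `flat-polygon-restriction-line`.
Nothing here is proved; the point is that the statements elaborate over existing declarations.
-/

namespace Summit.CriticalPhenomena.SAWScalingLimit.Cruxes.HexConjecture.Sketch

open Literature.Probability.RandomPlanarGeometry Literature.Probability.RandomPlanarGeometry.SAW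
open Literature.Probability.LatticeModels MeasureTheory

/-- Card `corner-phase-torque-pin`, first lemma (provable now from
`DuminilCopinSmirnov2012_lemma1_holds` by summing the vertex relation over `Λ`; interior mid-edges
cancel because `hexMidpoint` is the midpoint): the COMPLEX boundary flux identity of the critical
hexagonal SAW parafermion — for every simply connected domain and every boundary root `a`, the sum over
boundary mid-edges `{v,u}` (`v ∈ Λ`, `u ∉ Λ`) of (outward vector) × `F(a → {v,u})` vanishes, the
root itself contributing the trivial walk `F(a) = 1`.  Its real part (after multiplying by the
conjugate outward vector at `a`) is the Duminil-Copin–Smirnov / Glazman–Manolescu sum rule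
(`tri_identity`, `DuminilCopinSmirnov2012_lemma2` in the tree, positive `cos(3W/8)` weights); its
IMAGINARY part is the torque identity used by the card. -/
def BoundaryFluxIdentity : Prop :=
  ∀ Λ : Finset HexVertex, hexDomainSimplyConnected Λ →
    ∀ a ∈ hexDomainBoundary Λ,
      (∑ v ∈ Λ, ∑ᶠ u ∈ {u : HexVertex | hexGraph.Adj v u ∧ u ∉ Λ},
        (hexCenter u - hexCenter v) *
          hexParafermionicObservable Λ a hexCriticalFugacity (5 / 8) s(v, u)) = 0

/-- The Hermitian boundary matrix of a domain: `M a z = -(n_z / n_a) · F(a → z)` for boundary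
mid-edges `a = {v_a,u_a}`, `z = {v_z,u_z}` (`n` = outward unit vectors), `M a a = 0`.
`BoundaryFluxIdentity` says every row of `M` sums to `1`; reversal of walks (`W ↦ -W`, real weights)
makes `M` Hermitian.  (Typed as a function of the two oriented boundary edges.) -/
noncomputable def boundaryMatrix (Λ : Finset HexVertex) (va ua vz uz : HexVertex) : ℂ :=
  if s(va, ua) = s(vz, uz) then 0 else
    -(((hexCenter uz - hexCenter vz) / (‖hexCenter uz - hexCenter vz‖ : ℂ)) /
        ((hexCenter ua - hexCenter va) / (‖hexCenter ua - hexCenter va‖ : ℂ))) *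
      hexParafermionicObservable Λ s(va, ua) hexCriticalFugacity (5 / 8) s(vz, uz)

/-- Card `flat-polygon-restriction-line`, first lemma (restriction transfer, provable from exact
lattice restriction of `hexSAWLaw` + the SLE(8/3) restriction property + boundary avoidance of
SLE(8/3)): convergence to chordal SLE(8/3) in a Dobrushin domain `D` passes to every sub-domain `D'`
with the same marked points whose boundary agrees with `∂D` near both marks, for endpoint
approximations living in `D'`. -/
def RestrictionTransfer : Prop :=
  ∀ (D D' : DobrushinDomain) (a b : ℝ → HexVertex),
    D'.carrier ⊆ D.carrier → D'.pt 0 = D.pt 0 → D'.pt 1 = D.pt 1 →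
    (∃ ρ > (0 : ℝ), D'.carrier ∩ (Metric.ball (D.pt 0) ρ ∪ Metric.ball (D.pt 1) ρ) =
        D.carrier ∩ (Metric.ball (D.pt 0) ρ ∪ Metric.ball (D.pt 1) ρ)) →
    IsEmbEndpointApprox hexGraph hexCenter D a b →
    IsEmbEndpointApprox hexGraph hexCenter D' a b →
    ConvergesInLawToSLE ((8 : NNReal) / 3) D
        (fun δ (γ : HexDomainSAW D.carrier δ (a δ) (b δ)) => γ.curve)
        (fun δ => hexSAWLaw D.carrier δ (a δ) (b δ)) →
    ConvergesInLawToSLE ((8 : NNReal) / 3) D'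
        (fun δ (γ : HexDomainSAW D'.carrier δ (a δ) (b δ)) => γ.curve)
        (fun δ => hexSAWLaw D'.carrier δ (a δ) (b δ))

/-- The avoidance (restriction) ratio of the critical hexagonal SAW for nested domains at mesh `δ`:
`Z_{D'}(a_δ,b_δ) / Z_D(a_δ,b_δ)`, the total masses of `hexSAWWeight` (= `P_D(γ ⊂ D'_δ)` exactly when
`D'_δ` is an induced subdomain of `D_δ` containing the endpoints). -/
noncomputable def hexAvoidanceRatio (D D' : DobrushinDomain) (a b : ℝ → HexVertex) (δ : ℝ) :
    ENNReal :=
  hexSAWWeight D'.carrier δ (a δ) (b δ) Set.univ / hexSAWWeight D.carrier δ (a δ) (b δ) Set.univ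

/-- Card `critical-boundary-gram`, first lemma = the conjecture itself as a finite statement per domain
(F-PSD; verified by exact enumeration on ≈300 simply connected domains incl. slit domains, never violated): the
boundary-to-boundary parafermionic matrix `F_Λ(a,z) = hexParafermionicObservable Λ a x_c (5/8) z` (trivial walk on
the diagonal) is a positive semidefinite Hermitian kernel on `∂Λ`.  By `BoundaryFluxIdentity` the outward-normal
field lies in its kernel; numerically the kernel is exactly that line and (x_c, 5/8) is the threshold of
positivity in both parameters. -/
def BoundaryGramPSD : Prop :=
  ∀ Λ : Finset HexVertex, hexDomainSimplyConnected Λ →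
    ∀ c : Sym2 HexVertex → ℂ,
      0 ≤ (∑ᶠ a ∈ hexDomainBoundary Λ, ∑ᶠ z ∈ hexDomainBoundary Λ,
        (starRingEnd ℂ) (c a) * c z *
          hexParafermionicObservable Λ a hexCriticalFugacity (5 / 8) z).re

/-- Half-plane corollary of `BoundaryGramPSD` (Bochner on ℤ): with `G k` the critical half-plane boundary two-point
function of the hexagonal SAW (mid-edge `0` to mid-edge `k` on the boundary line), the sequence
`1, e^{±5πi/8} G(|k|)` is positive-definite, i.e. its Fourier series is nonnegative; if `G(k) ~ C k^{-2h}` this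
forces `h ≤ 5/8`.  Stated abstractly for a real sequence `G`. -/
def TwistedBoundarySequencePosDef (G : ℕ → ℝ) : Prop :=
  ∀ (n : ℕ) (c : Fin n → ℂ),
    0 ≤ (∑ j : Fin n, ∑ k : Fin n, (starRingEnd ℂ) (c j) * c k *
      (if (j : ℕ) = k then 1 else
        Complex.exp (Complex.I * (5 * Real.pi / 8) * (if (j : ℕ) < k then 1 else -1)) *
          (G (Int.natAbs ((j : ℤ) - k)) : ℂ))).re

end Summit.CriticalPhenomena.SAWScalingLimit.Cruxes.HexConjecture.Sketch
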